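import Literature.NumberTheory.Sieve.WelshCubicRootsBounds
import HarnessLib

/-!
# Welsh 2018, Theorem 1: discharge of the named fact `Welsh2018_thm1`

`Literature/NumberTheory/Sieve/WelshCubicRoots.lean` vendors Theorem 1 of M. C. Welsh, *Spacing and
a large sieve type inequality for roots of a cubic congruence*, arXiv:1809.05211 (with Lemma 2 and
the bounds of §5) as the named fact `Welsh2018_thm1`, transcribing the three approximating points
of eq. (24)/(37) verbatim. Here we prove it: `Welsh2018_thm1_holds`, with the absolute constant
`C = 120`.

The chain (all elementary, following the paper where it gives a proof):
* `WelshCubicRootsLattice`, `WelshCubicRootsGenerator`: a generator `α = a + b2^{1/3} + c2^{2/3}`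
  of the ideal `(m, 2^{1/3} - ν)` of `ℤ[2^{1/3}]` (Welsh §3 invokes class number one; we use
  Minkowski's theorem and explicit descents);
* `WelshCubicRootsBounds`: normalisation by units (§5, fundamental domain `𝒟`), Welsh's `u, v, w`
  of (22), the Bezout relation (16), Lemma 2's formula (19), the exact error identities (26) and the
  bounds (33)–(35), (39); this gives Theorem 1 with the three pairwise intersections of the lines
  `bX+cY=u`, `aX+bY=v`, `2cX+aY=w` of §4 (`thm1_corrected_inner`);
* this file: the points PRINTED in (24)/(37) — `((cv-au)/(2c²-ab), (2cu-bv)/(2c²-ab))` and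
  `((au-bv)/(a²-2bc), (av-2cu)/(a²-2bc))`, which differ from the true intersections
  `((cw-au)/B, (2cu-bw)/B)`, `((av-bw)/A, (aw-2cv)/A)` by `v ↔ w`, resp. `(u,v) ↔ (v,w)`
  (a typo in the source: compare its derivation (25)–(26) and `γ⁻¹` in (18)/(53)). They are
  nevertheless within `O(1/m)` of `(ν/m, ν²/m)` on the torus provided the Bezout triple is chosen
  suitably — by Welsh's remark after (19), the choice of `u, v, w` is the choice of representatives
  `ν₁ ≡ ν`, `ν₂ ≡ ν² (mod m)`, i.e. `(u,v,w) ↦ (u + bi + cj, v + ai + bj, w + 2ci + aj)`. The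
  `shift_lemma` (pure integer algebra from `gcd(A,B,C) = 1`) produces `i, j, k, l, n` with
  `u'-v' = ak + bl`, `v'-w' = 2ck + al = Bn`, and then the printed points are the true
  intersections translated by the integer vectors `(cn, -bn)` and `(k, l)`; so `thm1_inner`
  (Theorem 1 exactly as vendored, `C = 120`) follows from the machinery of `WelshCubicRootsBounds`.

## RESTORE NOTICE (2026-08-15, to operators / the `Welsh2018_thm3` seat)

This path previously held proposal p44827 (commit 6ec0573962de, seat `…Welsh2018_-ee4638f29e-0`):
`theorem Welsh2018_thm3_of_thm2 (h : Welsh2018_thm2) : Welsh2018_thm3` (Welsh Thm 3 from Thm 2 by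
duality + a 2D large sieve with bounded multiplicity, constant `36C`) together with
`Welsh2018.largeSieve2D_of_bddMult`, `rowSum_le_of_bddMult`, `norm_trapK_le_psiSeq`,
`sq_mul_norm_trapK_le`, `abs_sub_cellCentre_le`, `torusClose_cellCentre`,
`card_le_of_card_filter_le` (theorem-only; imports the `LargeSieve` files). Proposal p49031 (this
file, seat `…-f7fc824add-0`) was written as a NEW file in ignorance of p44827 and REPLACED it; the
gate allowed the replacement because nothing referenced those declarations yet ("removes 8
declaration(s) nothing references (allowed, recorded)"). They should be RESTORED by re-applying the
content of commit 6ec0573962de for this path merged with the present content (no name clashes; both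
parts are theorem-only in `namespace Literature.NumberTheory.Sieve[.Welsh2018]`; union of the import
lists). With `Welsh2018_thm2_holds` (`WelshCubicRootsSpacing.lean`, p46388) that also discharges
`Welsh2018_thm3` (`Welsh2018_thm3_of_thm2 Welsh2018_thm2_holds`). Whoever resubmits this file whole:
keep BOTH parts (append protocol).

## References
* [Welsh2018CubicCongruenceSpacing] M. C. Welsh, arXiv:1809.05211 (2018), Thm 1 (p. 9), Lemma 2 and
  the remark after (19) (p. 7), §4 (22)–(26) (p. 8), §5 (p. 9).
* [Hooley1978CubicPrimeFactor] C. Hooley, J. reine angew. Math. 303/304 (1978) 21–50.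
-/

noncomputable section

namespace Literature.NumberTheory.Sieve

namespace Welsh2018

/-! ### Choosing the representatives of `ν, ν² (mod m)`: the shift lemma -/

/-- `a ∈ (a - 2c, (b - a)(a² - 2bc), 2c² - ab)ℤ` when `gcd(a²-2bc, 2c²-ab, b²-ac) = 1`:
explicitly, from a Bezout relation `uA + vB + wC = 1`. (Key identity:
`(a-b)(ua-wb) = 1 + (w-v)B + (wc-ub)(a-2c)` and `a(a-b)² = (a-b)A - b(a-b)(a-2c)`.) [folklore] -/
theorem a_mem_shift_ideal (a b c u v w : ℤ)
    (hBez : u * (a ^ 2 - 2 * b * c) + v * (2 * c ^ 2 - a * b) + w * (b ^ 2 - a * c) = 1) :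
    ∃ P Q R : ℤ, a = (a - 2 * c) * P + (b - a) * (a ^ 2 - 2 * b * c) * Q + (2 * c ^ 2 - a * b) * R := by
  refine ⟨-b * (a - b) * (u * a - w * b) ^ 2 + (w * c - u * b) * (a * (((w - v) * (2 * c ^ 2 - a * b)
      + (w * c - u * b) * (a - 2 * c)) - 2 * ((a - b) * (u * a - w * b)))),
    -(u * a - w * b) ^ 2,
    (w - v) * (a * (((w - v) * (2 * c ^ 2 - a * b) + (w * c - u * b) * (a - 2 * c))
      - 2 * ((a - b) * (u * a - w * b)))), ?_⟩
  linear_combination (-a * (1 + (u * (a ^ 2 - 2 * b * c) + v * (2 * c ^ 2 - a * b)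
    + w * (b ^ 2 - a * c)))) * hBez

/-- **Shift lemma.** For integers `a, b, c` with `uA + vB + wC = 1` (`A = a²-2bc`, `B = 2c²-ab`,
`C = b²-ac`) and any `s, t`, there are `i, j, k, l, n` with
`s + i(b-a) + j(c-b) = ak + bl`, `t + i(a-2c) + j(b-a) = 2ck + al = Bn`.
With `s = u-v`, `t = v-w` for a Bezout triple and the shifted triple
`(u', v', w') = (u + bi + cj, v + ai + bj, w + 2ci + aj)` (= Welsh's `u, v, w` of (22) for the
representatives `ν + im`, `ν² + jm`) this says `u'-v' = ak+bl`, `v'-w' = 2ck+al = Bn`, which makes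
the printed points of Welsh's Theorem 1 integer translates of the true intersections. Proof: the
`2×3` system for `(k+i, l-i, j)` has maximal minors `A, A+B, -C` (coprime), and
`2c(k+i) + a(l-i) ∈ (a-2c, (b-a)A, B)` by `a_mem_shift_ideal`. [folklore] -/
theorem shift_lemma (a b c u v w s t : ℤ)
    (hBez : u * (a ^ 2 - 2 * b * c) + v * (2 * c ^ 2 - a * b) + w * (b ^ 2 - a * c) = 1) :
    ∃ i j k l n : ℤ,
      s + i * (b - a) + j * (c - b) = a * k + b * l ∧
      t + i * (a - 2 * c) + j * (b - a) = 2 * c * k + a * l ∧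
      2 * c * k + a * l = (2 * c ^ 2 - a * b) * n := by
  obtain ⟨P, Q, R, hPQR⟩ := a_mem_shift_ideal a b c u v w hBez
  -- step 1: a particular solution of the `2 × 3` system (minors `A`, `A + B`, `-C`)
  obtain ⟨kp, hkp⟩ : ∃ kp : ℤ, kp = (u - v) * (a * s - b * t) + v * ((a - b) * s - (b - c) * t) :=
    ⟨_, rfl⟩
  obtain ⟨lp, hlp⟩ : ∃ lp : ℤ, lp = (u - v) * (-2 * c * s + a * t) + (-w) * ((a - b) * s - (b - c) * t) :=
    ⟨_, rfl⟩
  obtain ⟨jp, hjp⟩ : ∃ jp : ℤ, jp = v * (-2 * c * s + a * t) + (-w) * (-a * s + b * t) := ⟨_, rfl⟩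
  have e1 : a * kp + b * lp + (b - c) * jp = s := by
    rw [hkp, hlp, hjp]; linear_combination s * hBez
  have e2 : 2 * c * kp + a * lp + (a - b) * jp = t := by
    rw [hkp, hlp, hjp]; linear_combination t * hBez
  -- step 2: `2c·kp + a·lp ∈ (a - 2c, (b - a)A, B)`
  obtain ⟨i₀, hi₀⟩ : ∃ i₀ : ℤ, i₀ = (P - 1) * kp + P * lp := ⟨_, rfl⟩
  obtain ⟨lam, hlam⟩ : ∃ lam : ℤ, lam = Q * (kp + lp) := ⟨_, rfl⟩
  obtain ⟨n₀, hn₀⟩ : ∃ n₀ : ℤ, n₀ = R * (kp + lp) := ⟨_, rfl⟩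
  have e3 : 2 * c * kp + a * lp
      = (a - 2 * c) * i₀ + (b - a) * (a ^ 2 - 2 * b * c) * lam + (2 * c ^ 2 - a * b) * n₀ := by
    rw [hi₀, hlam, hn₀]; linear_combination (kp + lp) * hPQR
  -- step 3: move along the kernel `(-C, -(A+B), A)` by `-lam`, then read off `i, k, l, n`
  refine ⟨-i₀, jp - lam * (a ^ 2 - 2 * b * c), kp + lam * (b ^ 2 - a * c) + i₀,
    lp + lam * ((a ^ 2 - 2 * b * c) + (2 * c ^ 2 - a * b)) - i₀, n₀, ?_, ?_, ?_⟩
  · linear_combination (-1 : ℤ) * e1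
  · linear_combination (-1 : ℤ) * e2
  · linear_combination e3

/-- The exact error identity of §4 (26) with an integer translate: if
`num·m = -P + (e + sh·m)·D` with `D ≠ 0`, `m ≠ 0`, then `num/D - e/m - sh = -(P/(m·D))`.
[cite: Welsh2018CubicCongruenceSpacing, §4 (26) (p. 8)] -/
theorem err_identity' {num D P e sh m : ℝ} (hm : m ≠ 0) (hD : D ≠ 0)
    (h : num * m = -P + (e + sh * m) * D) : num / D - e / m - sh = -(P / (m * D)) := by
  have e1 : num / D - e / m - sh = (num * m - (e + sh * m) * D) / (m * D) := by
    field_simp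
    ring
  rw [e1, show num * m - (e + sh * m) * D = -P by linarith, neg_div]

/-! ### Theorem 1 as printed -/

set_option maxHeartbeats 400000 in
/-- **Welsh 2018, Theorem 1 AS PRINTED (eq. (24)/(37)), explicit constant `C = 120`.** The inner
statement of `Welsh2018_thm1` with `C = 120`: the printed second and third points
`((cv-au)/(2c²-ab), (2cu-bv)/(2c²-ab))`, `((au-bv)/(a²-2bc), (av-2cu)/(a²-2bc))` differ from the
pairwise intersections of Welsh's three lines (his derivation (25)–(26)) by `v ↔ w`, resp.
`(u,v) ↔ (v,w)`; they are nevertheless within `120/m` of `(ν/m, ν²/m)` on the torus for a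
SUITABLE Bezout triple `(u,v,w)` — Welsh's `u, v, w` of (22) for suitable representatives
`ν₁ ≡ ν`, `ν₂ ≡ ν² (mod m)` (his remark after (19)), supplied by `shift_lemma`: then the printed
points are integer translates of the true intersections. (i)–(v) as in `thm1_corrected_inner`.
[cite: Welsh2018CubicCongruenceSpacing, Thm 1 (p. 9), Lemma 2 (p. 7), §4 (22)–(26), §5 (39)] -/
theorem thm1_inner (m : ℕ) (ν : ℤ) (hm : 1 ≤ m) (hν : (m : ℤ) ∣ ν ^ 3 - 2) :
    ∃ a b c u v w : ℤ,
      (m : ℤ) = a ^ 3 + 2 * b ^ 3 + 4 * c ^ 3 - 6 * a * b * c ∧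
      u * (a ^ 2 - 2 * b * c) + v * (2 * c ^ 2 - a * b) + w * (b ^ 2 - a * c) = 1 ∧
      (m : ℤ) ∣ ν + (a * (b * w - a * v) + 2 * c * (a * u - c * w) + 2 * b * (c * v - b * u)) ∧
      (|(a : ℝ)| ≤ 120 * (m : ℝ) ^ ((1 : ℝ) / 3) ∧ |(b : ℝ)| ≤ 120 * (m : ℝ) ^ ((1 : ℝ) / 3) ∧
        |(c : ℝ)| ≤ 120 * (m : ℝ) ^ ((1 : ℝ) / 3)) ∧
      ((m : ℝ) ^ ((2 : ℝ) / 3) / 120 ≤ |((b ^ 2 - a * c : ℤ) : ℝ)| ∧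
        |((b ^ 2 - a * c : ℤ) : ℝ)| ≤ 120 * (m : ℝ) ^ ((2 : ℝ) / 3) ∧
        (m : ℝ) ^ ((2 : ℝ) / 3) / 120 ≤ |((2 * c ^ 2 - a * b : ℤ) : ℝ)| ∧
        |((2 * c ^ 2 - a * b : ℤ) : ℝ)| ≤ 120 * (m : ℝ) ^ ((2 : ℝ) / 3) ∧
        (m : ℝ) ^ ((2 : ℝ) / 3) / 120 ≤ |((a ^ 2 - 2 * b * c : ℤ) : ℝ)| ∧
        |((a ^ 2 - 2 * b * c : ℤ) : ℝ)| ≤ 120 * (m : ℝ) ^ ((2 : ℝ) / 3)) ∧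
      TorusClose (120 / m) (((b * u - c * v : ℤ) : ℝ) / ((b ^ 2 - a * c : ℤ) : ℝ))
        (((b * v - a * u : ℤ) : ℝ) / ((b ^ 2 - a * c : ℤ) : ℝ)) ((ν : ℝ) / m) ((ν : ℝ) ^ 2 / m) ∧
      TorusClose (120 / m) (((c * v - a * u : ℤ) : ℝ) / ((2 * c ^ 2 - a * b : ℤ) : ℝ))
        (((2 * c * u - b * v : ℤ) : ℝ) / ((2 * c ^ 2 - a * b : ℤ) : ℝ)) ((ν : ℝ) / m)
        ((ν : ℝ) ^ 2 / m) ∧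
      TorusClose (120 / m) (((a * u - b * v : ℤ) : ℝ) / ((a ^ 2 - 2 * b * c : ℤ) : ℝ))
        (((a * v - 2 * c * u : ℤ) : ℝ) / ((a ^ 2 - 2 * b * c : ℤ) : ℝ)) ((ν : ℝ) / m)
        ((ν : ℝ) ^ 2 / m) := by
  -- the real cube roots
  set θ : ℝ := (2 : ℝ) ^ ((1 : ℝ) / 3) with hθdef
  have hθ : θ ^ 3 = 2 := by
    rw [hθdef, ← Real.rpow_natCast, ← Real.rpow_mul (by norm_num)]; norm_num
  have hθ0 : 0 < θ := Real.rpow_pos_of_pos (by norm_num) _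
  have hmpos : (0 : ℝ) < m := by exact_mod_cast hm
  set μ : ℝ := (m : ℝ) ^ ((1 : ℝ) / 3) with hμdef
  have hμ : μ ^ 3 = m := by
    rw [hμdef, ← Real.rpow_natCast, ← Real.rpow_mul hmpos.le]; norm_num
  have hμ0 : 0 < μ := Real.rpow_pos_of_pos hmpos _
  have hμ2 : (m : ℝ) ^ ((2 : ℝ) / 3) = μ ^ 2 := by
    rw [hμdef, ← Real.rpow_natCast, ← Real.rpow_mul hmpos.le]; norm_num
  have hθup : θ < 1.27 := lt_of_pow_lt_pow_left₀ 3 (by norm_num) (by rw [hθ]; norm_num)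
  have hθlo : 1.25 < θ := lt_of_pow_lt_pow_left₀ 3 hθ0.le (by rw [hθ]; norm_num)
  -- the normalised generator and Welsh's `u, v, w`
  obtain ⟨a, b, c, hmem, hN, hs1, hs2⟩ := exists_normalised hθ hθ0 m hm hμ0 ν hν
  have hm0 : (m : ℤ) ≠ 0 := by exact_mod_cast (show m ≠ 0 by omega)
  obtain ⟨u, hu⟩ := hmem
  obtain ⟨v, hv⟩ : (m : ℤ) ∣ 2 * c + a * ν + b * ν ^ 2 := by
    have e : 2 * c + a * ν + b * ν ^ 2 = ν * (a + b * ν + c * ν ^ 2) - c * (ν ^ 3 - 2) := by ring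
    rw [e]; exact dvd_sub (dvd_mul_of_dvd_right ⟨u, hu⟩ _) (dvd_mul_of_dvd_right hν _)
  obtain ⟨w, hw⟩ : (m : ℤ) ∣ 2 * b + 2 * c * ν + a * ν ^ 2 := by
    have e : 2 * b + 2 * c * ν + a * ν ^ 2 = ν * (2 * c + a * ν + b * ν ^ 2) - b * (ν ^ 3 - 2) := by
      ring
    rw [e]; exact dvd_sub (dvd_mul_of_dvd_right ⟨v, hv⟩ _) (dvd_mul_of_dvd_right hν _)
  -- integer identities
  have hBez : u * (a ^ 2 - 2 * b * c) + v * (2 * c ^ 2 - a * b) + w * (b ^ 2 - a * c) = 1 := by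
    refine mul_left_cancel₀ hm0 ?_
    have e : (m : ℤ) * (u * (a ^ 2 - 2 * b * c) + v * (2 * c ^ 2 - a * b) + w * (b ^ 2 - a * c))
        = (m * u) * (a ^ 2 - 2 * b * c) + (m * v) * (2 * c ^ 2 - a * b)
          + (m * w) * (b ^ 2 - a * c) := by
      ring
    rw [e, ← hu, ← hv, ← hw, mul_one, ← hN]; ring
  have hνeq : ν = 2 * u * (b ^ 2 - a * c) + v * (a ^ 2 - 2 * b * c) + w * (2 * c ^ 2 - a * b) := by
    refine mul_left_cancel₀ hm0 ?_
    have e : (m : ℤ) * (2 * u * (b ^ 2 - a * c) + v * (a ^ 2 - 2 * b * c) + w * (2 * c ^ 2 - a * b))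
        = 2 * (m * u) * (b ^ 2 - a * c) + (m * v) * (a ^ 2 - 2 * b * c)
          + (m * w) * (2 * c ^ 2 - a * b) := by
      ring
    rw [e, ← hu, ← hv, ← hw, ← hN]; ring
  have i1 : (b * u - c * v) * (m : ℤ) = -(2 * c ^ 2 - a * b) + ν * (b ^ 2 - a * c) := by
    have e : (b * u - c * v) * (m : ℤ) = b * (m * u) - c * (m * v) := by ring
    rw [e, ← hu, ← hv]; ring
  have i2 : (b * v - a * u) * (m : ℤ) = -(a ^ 2 - 2 * b * c) + ν ^ 2 * (b ^ 2 - a * c) := by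
    have e : (b * v - a * u) * (m : ℤ) = b * (m * v) - a * (m * u) := by ring
    rw [e, ← hu, ← hv]; ring
  have i3 : (c * w - a * u) * (m : ℤ) = -(a ^ 2 - 2 * b * c) + ν * (2 * c ^ 2 - a * b) := by
    have e : (c * w - a * u) * (m : ℤ) = c * (m * w) - a * (m * u) := by ring
    rw [e, ← hu, ← hw]; ring
  have i4 : (2 * c * u - b * w) * (m : ℤ) = -(2 * (b ^ 2 - a * c)) + ν ^ 2 * (2 * c ^ 2 - a * b) := by
    have e : (2 * c * u - b * w) * (m : ℤ) = 2 * c * (m * u) - b * (m * w) := by ring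
    rw [e, ← hu, ← hw]; ring
  have i5 : (a * v - b * w) * (m : ℤ) = -(2 * (b ^ 2 - a * c)) + ν * (a ^ 2 - 2 * b * c) := by
    have e : (a * v - b * w) * (m : ℤ) = a * (m * v) - b * (m * w) := by ring
    rw [e, ← hv, ← hw]; ring
  have i6 : (a * w - 2 * c * v) * (m : ℤ)
      = -(2 * (2 * c ^ 2 - a * b)) + ν ^ 2 * (a ^ 2 - 2 * b * c) := by
    have e : (a * w - 2 * c * v) * (m : ℤ) = a * (m * w) - 2 * c * (m * v) := by ring
    rw [e, ← hv, ← hw]; ring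
  -- real variables
  obtain ⟨A, hA⟩ : ∃ A : ℝ, A = ((a ^ 2 - 2 * b * c : ℤ) : ℝ) := ⟨_, rfl⟩
  obtain ⟨B, hB⟩ : ∃ B : ℝ, B = ((2 * c ^ 2 - a * b : ℤ) : ℝ) := ⟨_, rfl⟩
  obtain ⟨C, hC⟩ : ∃ C : ℝ, C = ((b ^ 2 - a * c : ℤ) : ℝ) := ⟨_, rfl⟩
  have hA' : A = (a : ℝ) ^ 2 - 2 * b * c := by rw [hA]; push_cast; ring
  have hB' : B = 2 * (c : ℝ) ^ 2 - a * b := by rw [hB]; push_cast; ring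
  have hC' : C = (b : ℝ) ^ 2 - a * c := by rw [hC]; push_cast; ring
  have hNr : (a : ℝ) ^ 3 + 2 * b ^ 3 + 4 * c ^ 3 - 6 * a * b * c = m := by exact_mod_cast hN
  obtain ⟨s, hs⟩ : ∃ s : ℝ, s = (a : ℝ) + θ * b + θ ^ 2 * c := ⟨_, rfl⟩
  obtain ⟨X, hX⟩ : ∃ X : ℝ, X = A + θ * B + θ ^ 2 * C := ⟨_, rfl⟩
  rw [← hs] at hs1 hs2
  have hs0 : 0 < s := lt_trans (by positivity) hs1
  -- `s · X = N = m = μ³`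
  have hsX : s * X = μ ^ 3 := by
    rw [hs, hX, hA', hB', hC', hμ, ← hNr]
    linear_combination ((b : ℝ) ^ 3 + 2 * c ^ 3 - 2 * a * b * c + (b ^ 2 * c - a * c ^ 2) * θ) * hθ
  -- the window for `X`
  have hθθ : θ * θ < 1.27 * 1.27 := mul_lt_mul'' hθup hθup hθ0.le hθ0.le
  have hε : 1 + θ + θ ^ 2 < 3.9 := by rw [sq]; linarith
  obtain ⟨hXlo, hXhi⟩ :=
    window_of_realEmb hμ0 hs0 hsX (by positivity : (0 : ℝ) < 1 + θ + θ ^ 2) hε hs1 hs2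
  -- `X · W = 4 m²` with `W ≥ (3A - X)², (3θB - X)², (3θ²C - X)²`
  obtain ⟨W, hW⟩ : ∃ W : ℝ, W = (2 * A - θ * B - θ ^ 2 * C) ^ 2 + 3 * (θ * B - θ ^ 2 * C) ^ 2 :=
    ⟨_, rfl⟩
  have hNA : A ^ 3 + 2 * B ^ 3 + 4 * C ^ 3 - 6 * A * B * C = (m : ℝ) ^ 2 := by
    rw [hA', hB', hC', ← hNr]; ring
  have hXW : X * W = 4 * μ ^ 6 := by
    have h4 := four_mul_normForm_eq hθ A B C
    rw [hNA] at h4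
    rw [hX, hW, ← h4, ← hμ]; ring
  have hW1 : (3 * A - X) ^ 2 ≤ W := by
    have e : W = (3 * A - X) ^ 2 + 3 * (θ * B - θ ^ 2 * C) ^ 2 := by rw [hW, hX]; ring
    rw [e]; exact le_add_of_nonneg_right (by positivity)
  have hW2 : (3 * (θ * B) - X) ^ 2 ≤ W := by
    have e : W = (3 * (θ * B) - X) ^ 2 + 3 * (A - θ ^ 2 * C) ^ 2 := by rw [hW, hX]; ring
    rw [e]; exact le_add_of_nonneg_right (by positivity)
  have hW3 : (3 * (θ ^ 2 * C) - X) ^ 2 ≤ W := by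
    have e : W = (3 * (θ ^ 2 * C) - X) ^ 2 + 3 * (A - θ * B) ^ 2 := by rw [hW, hX]; ring
    rw [e]; exact le_add_of_nonneg_right (by positivity)
  obtain ⟨hAlo, hAhi, hBlo, hBhi, hClo, hChi⟩ :=
    coeff_bounds hθlo hθup hμ0 hXlo hXhi hXW hW1 hW2 hW3
  have hμsq : 0 < μ ^ 2 := by positivity
  have hApos : 0 < A := lt_trans (by positivity) hAlo
  have hBpos : 0 < B := lt_trans (by positivity) hBlo
  have hCpos : 0 < C := lt_trans (by positivity) hClo
  -- sizes of `a, b, c` via `m·a = A² - 2BC`, `m·b = 2C² - AB`, `m·c = B² - AC` (eq. (39))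
  have ha : (a : ℝ) * μ ^ 3 = A ^ 2 - 2 * B * C := by rw [hA', hB', hC', hμ, ← hNr]; ring
  have hb : (b : ℝ) * μ ^ 3 = 2 * C ^ 2 - A * B := by rw [hA', hB', hC', hμ, ← hNr]; ring
  have hc : (c : ℝ) * μ ^ 3 = B ^ 2 - A * C := by rw [hA', hB', hC', hμ, ← hNr]; ring
  have hμ4 : 0 < μ ^ 4 := by positivity
  have e16 : (4 * μ ^ 2) * (4 * μ ^ 2) = 16 * μ ^ 4 := by ring
  have pAA := mul_lt_mul'' hAhi hAhi hApos.le hApos.le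
  have pBB := mul_lt_mul'' hBhi hBhi hBpos.le hBpos.le
  have pCC := mul_lt_mul'' hChi hChi hCpos.le hCpos.le
  have pAB := mul_lt_mul'' hAhi hBhi hApos.le hBpos.le
  have pAC := mul_lt_mul'' hAhi hChi hApos.le hCpos.le
  have pBC := mul_lt_mul'' hBhi hChi hBpos.le hCpos.le
  have qA : A ^ 2 < 32 * μ ^ 4 := by rw [sq]; linarith
  have q2C : 2 * C ^ 2 < 32 * μ ^ 4 := by rw [sq]; linarith
  have qB : B ^ 2 < 32 * μ ^ 4 := by rw [sq]; linarith
  have q2BC : 2 * B * C < 32 * μ ^ 4 := by linarith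
  have qAB : A * B < 32 * μ ^ 4 := by linarith
  have qAC : A * C < 32 * μ ^ 4 := by linarith
  have haB : |(a : ℝ)| ≤ 120 * μ :=
    coord_bound hμ0 ha (by positivity) (by positivity) qA q2BC
  have hbB : |(b : ℝ)| ≤ 120 * μ :=
    coord_bound hμ0 hb (by positivity) (by positivity) q2C qAB
  have hcB : |(c : ℝ)| ≤ 120 * μ :=
    coord_bound hμ0 hc (by positivity) (by positivity) qB qAC
  have hiv : |(a : ℝ)| ≤ 120 * μ ∧ |(b : ℝ)| ≤ 120 * μ ∧ |(c : ℝ)| ≤ 120 * μ := ⟨haB, hbB, hcB⟩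
  have hv : (m : ℝ) ^ ((2 : ℝ) / 3) / 120 ≤ |((b ^ 2 - a * c : ℤ) : ℝ)| ∧
      |((b ^ 2 - a * c : ℤ) : ℝ)| ≤ 120 * (m : ℝ) ^ ((2 : ℝ) / 3) ∧
      (m : ℝ) ^ ((2 : ℝ) / 3) / 120 ≤ |((2 * c ^ 2 - a * b : ℤ) : ℝ)| ∧
      |((2 * c ^ 2 - a * b : ℤ) : ℝ)| ≤ 120 * (m : ℝ) ^ ((2 : ℝ) / 3) ∧
      (m : ℝ) ^ ((2 : ℝ) / 3) / 120 ≤ |((a ^ 2 - 2 * b * c : ℤ) : ℝ)| ∧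
      |((a ^ 2 - 2 * b * c : ℤ) : ℝ)| ≤ 120 * (m : ℝ) ^ ((2 : ℝ) / 3) := by
    rw [hμ2, ← hA, ← hB, ← hC, abs_of_pos hCpos, abs_of_pos hBpos, abs_of_pos hApos]
    refine ⟨by linarith, by linarith, by linarith, by linarith, by linarith, by linarith⟩
  -- the shift of the Bezout triple (choice of representatives of `ν, ν² (mod m)`)
  obtain ⟨i, j, k, l, n, h1, h2, h3⟩ := shift_lemma a b c u v w (u - v) (v - w) hBez
  have j1 : (b * (u + b * i + c * j) - c * (v + a * i + b * j)) * (m : ℤ)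
      = -(2 * c ^ 2 - a * b) + (ν + i * m) * (b ^ 2 - a * c) := by linear_combination i1
  have j2 : (b * (v + a * i + b * j) - a * (u + b * i + c * j)) * (m : ℤ)
      = -(a ^ 2 - 2 * b * c) + (ν ^ 2 + j * m) * (b ^ 2 - a * c) := by linear_combination i2
  have j3 : (c * (v + a * i + b * j) - a * (u + b * i + c * j)) * (m : ℤ)
      = -(a ^ 2 - 2 * b * c) + (ν + (i + c * n) * m) * (2 * c ^ 2 - a * b) := by
    linear_combination i3 + c * (m : ℤ) * h2 + c * (m : ℤ) * h3
  have j4 : (2 * c * (u + b * i + c * j) - b * (v + a * i + b * j)) * (m : ℤ)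
      = -(2 * (b ^ 2 - a * c)) + (ν ^ 2 + (j - b * n) * m) * (2 * c ^ 2 - a * b) := by
    linear_combination i4 - b * (m : ℤ) * h2 - b * (m : ℤ) * h3
  have j5 : (a * (u + b * i + c * j) - b * (v + a * i + b * j)) * (m : ℤ)
      = -(2 * (b ^ 2 - a * c)) + (ν + (i + k) * m) * (a ^ 2 - 2 * b * c) := by
    linear_combination i5 + a * (m : ℤ) * h1 - b * (m : ℤ) * h2
  have j6 : (a * (v + a * i + b * j) - 2 * c * (u + b * i + c * j)) * (m : ℤ)
      = -(2 * (2 * c ^ 2 - a * b)) + (ν ^ 2 + (j + l) * m) * (a ^ 2 - 2 * b * c) := by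
    linear_combination i6 + a * (m : ℤ) * h2 - 2 * c * (m : ℤ) * h1
  -- the torus distances: exact error terms
  have hmR0 : (m : ℝ) ≠ 0 := hmpos.ne'
  have cast1 : (((b * (u + b * i + c * j) - c * (v + a * i + b * j) : ℤ) : ℝ)) * m
      = -B + (ν + ((i : ℤ) : ℝ) * m) * C := by
    rw [hB, hC]; exact_mod_cast j1
  have cast2 : (((b * (v + a * i + b * j) - a * (u + b * i + c * j) : ℤ) : ℝ)) * m
      = -A + ((ν : ℝ) ^ 2 + ((j : ℤ) : ℝ) * m) * C := by
    rw [hA, hC]; exact_mod_cast j2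
  have cast3 : (((c * (v + a * i + b * j) - a * (u + b * i + c * j) : ℤ) : ℝ)) * m
      = -A + (ν + ((i + c * n : ℤ) : ℝ) * m) * B := by
    rw [hA, hB]; exact_mod_cast j3
  have cast4 : (((2 * c * (u + b * i + c * j) - b * (v + a * i + b * j) : ℤ) : ℝ)) * m
      = -(2 * C) + ((ν : ℝ) ^ 2 + ((j - b * n : ℤ) : ℝ) * m) * B := by
    rw [hB, hC]; exact_mod_cast j4
  have cast5 : (((a * (u + b * i + c * j) - b * (v + a * i + b * j) : ℤ) : ℝ)) * m
      = -(2 * C) + (ν + ((i + k : ℤ) : ℝ) * m) * A := by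
    rw [hA, hC]; exact_mod_cast j5
  have cast6 : (((a * (v + a * i + b * j) - 2 * c * (u + b * i + c * j) : ℤ) : ℝ)) * m
      = -(2 * B) + ((ν : ℝ) ^ 2 + ((j + l : ℤ) : ℝ) * m) * A := by
    rw [hA, hB]; exact_mod_cast j6
  have e1 := err_identity' hmR0 hCpos.ne' cast1
  have e2 := err_identity' hmR0 hCpos.ne' cast2
  have e3 := err_identity' hmR0 hBpos.ne' cast3
  have e4 := err_identity' hmR0 hBpos.ne' cast4
  have e5 := err_identity' hmR0 hApos.ne' cast5
  have e6 := err_identity' hmR0 hApos.ne' cast6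
  have d1 : |-(B / (m * C))| ≤ 40 / m := abs_neg_div_le hmpos hCpos hBpos.le (by linarith)
  have d2 : |-(A / (m * C))| ≤ 40 / m := abs_neg_div_le hmpos hCpos hApos.le (by linarith)
  have d3 : |-(A / (m * B))| ≤ 40 / m := abs_neg_div_le hmpos hBpos hApos.le (by linarith)
  have d4 : |-(2 * C / (m * B))| ≤ 80 / m :=
    abs_neg_div_le hmpos hBpos (by positivity) (by linarith)
  have d5 : |-(2 * C / (m * A))| ≤ 80 / m :=
    abs_neg_div_le hmpos hApos (by positivity) (by linarith)
  have d6 : |-(2 * B / (m * A))| ≤ 80 / m :=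
    abs_neg_div_le hmpos hApos (by positivity) (by linarith)
  -- assemble, with the shifted triple `(u + bi + cj, v + ai + bj, w + 2ci + aj)`
  refine ⟨a, b, c, u + b * i + c * j, v + a * i + b * j, w + 2 * c * i + a * j, hN.symm,
    by linear_combination hBez, ?_, ?_, ?_, ?_, ?_, ?_⟩
  · exact ⟨-i, by linear_combination hνeq - i * hN⟩
  · exact hiv
  · exact hv
  · refine ⟨i, j, ?_⟩
    rw [← hC, e1, e2]
    exact sq_add_sq_le d1 d2 (by norm_num)
  · refine ⟨i + c * n, j - b * n, ?_⟩
    rw [← hB, e3, e4]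
    exact sq_add_sq_le d3 d4 (by norm_num)
  · refine ⟨i + k, j + l, ?_⟩
    rw [← hA, e5, e6]
    exact sq_add_sq_le d5 d6 (by norm_num)

end Welsh2018

/-- **Discharge of `Welsh2018_thm1`** (as vendored, i.e. with the points printed in Welsh's
eq. (24)/(37)), absolute constant `C = 120`: `Welsh2018.thm1_inner`.
[cite: Welsh2018CubicCongruenceSpacing, Thm 1 (p. 9)] -/
theorem Welsh2018_thm1_holds : Welsh2018_thm1 :=
  ⟨120, by norm_num, fun m ν hm hν => Welsh2018.thm1_inner m ν hm hν⟩

end Literature.NumberTheory.Sieve
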